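import Summits.QuantumFields.BalabanUV.Beta.GAN24.WilsonJetGaugeLeg
import Summits.QuantumFields.BalabanUV.Beta.WilsonStencilDivergence

/-!
# `GAN24.WilsonStencilGaugeLeg` — the TABLE-leg (gauge-leg) Ward law of the antisymmetrised colourless Wilson stencil on a finite lattice:
# `Σ_p dℓ(p)·S₀A(z,γ; p, q) = (ℓ(z + e_γ) − ½(ℓ q.1 + ℓ(q.1 + e_{q.2})))·Lc e q.2 q.1 (z,γ)` — TIP on the index bond, MIDPOINT on the co-leg

HONEST FRAMING (cell charter, verbatim): «discharging `BetaPertH` makes Bałaban's UV stability UNCONDITIONAL — a real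
constructive-QFT result; it is NOT the continuum limit and NOT the Clay problem.»  DERIVED cell leaf (pub-balaban, G-an2-4
formalisation swarm → CRUX TEAM (2), seat `b2b-balaban-gan24-formalise-leaf-02`, gen 45; stage 2 of CT-ROUTE's step (CT-1) «the TABLE-leg
cubic Ward identity» at the tree's object, toward the row owner's INTERFACE REQUEST G-an2-4 of 2026-08-21T10:11Z): finite-dimensional
linear algebra over an arbitrary finite abelian lattice, no estimate, no limit, nothing cited — every statement is kernel-proved here
([folklore] = standard finite algebra); no `[cite:]` tag, no `def … : Prop`; it instantiates NO binder of the β-function wall and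
discharges NO letter of (CONV-C).  NEVER «G-an2-4 closed»; NOT hSrow, NOT D1, NOT `BetaPertH`, NOT continuum, NOT Clay.
HONEST DEPENDENCY (cell records, verbatim): «continuum YM on T⁴ ⇐ BetaPertH ∧ nine spine estimates (0/9 proved); BetaPertH ⇐ (D1) ∧
(D4) ∧ CAP+tail; G-an2-4 gates asym, D1 and NE2/3/4.»
ABSOLUTE RULE (cell charter, verbatim): «No internally-minted statement may enter as a cited fact. Every hypothesis is either
kernel-proved in this package or a verbatim quotation of a PUBLISHED theorem with page reference. The manuscript(s) under audit are
NOT citable for their own disputed steps — they are the thing under adjudication; programme-internal (2001/route/tribunal) claims are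
never citable.»

THE CHAIN (the twin of D1-leaf-05's `WilsonStencilDivergence` for a pure gauge on a FLUCTUATION (table) leg instead of the BACKGROUND
(index) leg).  `WilsonJetGaugeLeg.jet21_polar_grad` (the `W`-bilinear cross term of an3's summed `(2,1)`-jet with one fluctuation leg
`grad e λ`: `½•τ(lcurl B · lcurl (midBr λ W)) + τ(lcurl W · lcurl (tipAdj λ B))`) is read, for the coordinate field `W = field t v`, the
pure gauge `λ = ℓ • t_c` (i.e. the colour-supported vector `cvec c (dℓ)`, `field_cvec_grad`) and the one-bond background
`B = bondLetter z γ Y`, through an3's headline `PlaquetteStencil.actionJet21_eq_wilsonVertex₁` on the left (`jet21_field_bondLetter`) and through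
`midBr_smul_field` ∕ `tipAdj_bondLetter` ∕ `lcurl_field` on the right (`rhs_mid_coords`, `rhs_tip_coords`) ⇒ the BILINEAR-FORM LAW
`bilinear_gauge_law`:  `v ⬝ᵥ W v′ + v′ ⬝ᵥ W v = −½·Σ lcurl δ_{(z,γ)}·Σ_b (adM Y)_{cb}·lcurl (coords (bondMul ℓ v))_b + ℓ(z + e_γ)·Σ lcurl
δ_{(z,γ)}·Σ_a (adM Y)_{ca}·lcurl (coords v)_a`  (`W = wilsonVertex₁ e z γ (adM Y)`, `v′ = cvec c (dℓ)`).  At the test vector `v = cvec b δ_q`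
(`WilsonReflectionFrame.cvec_wilsonVertex₁_cvec`) this is the ENTRYWISE LAW WITH COLOUR (`entry_gauge_law_colour`, a multiple of
`(adM Y)_{cb}`; the antisymmetrised stencil `S₀A` appears because the two cross terms carry `(adM Y)_{bc} = −(adM Y)_{cb}`); the curl–curl
matrix is twice an3's contact coefficient (`WilsonStencilDivergence.curlCurl_eq_two_mul_Lc`); and the non-degenerate quaternion witness
`WilsonStencilReflection.adM_witnessH` strips the colour:

**`S₀A_gaugeLeg : Σ_p (ℓ(p.1 + e_{p.2}) − ℓ p.1) · S₀A e z γ p q = (ℓ(z + e_γ) − ½(ℓ q.1 + ℓ(q.1 + e_{q.2}))) · Lc e q.2 q.1 (z, γ)`**, and at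
one site **`S₀A_gaugeLeg_div : Σ_κ (S₀A e z γ (u − e_κ, κ) q − S₀A e z γ (u, κ) q) = ([z + e_γ = u] − ½([q.1 = u] + [q.1 + e_{q.2} = u])) ·
Lc e q.2 q.1 (z, γ)`**

— on every finite abelian lattice with frame `e`: the antisymmetrised colourless Wilson stencil (`WilsonReflectionFrame.S₀A`; on `ℤ^(d+1)`
its entries are an2's `StepJetData.wilsonA` field block) contracted with a pure gauge on a TABLE leg is the curl–curl contact `Lc` between the
INDEX bond and the OTHER table leg, weighted by the TIP value of the gauge function on the index bond minus its MIDPOINT value on the other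
leg.  Side by side with the INDEX-leg law `WilsonStencilDivergence.S₀A_grad` (SITE values `ℓ q.1 − ℓ p.1`): the three pure-gauge laws of the
tree's cubic Wilson table are now all kernel theorems on finite lattices.  The transfer to `ℤ^(d+1)` (`WilsonDivergenceContact` pattern:
torus embedding `WilsonStencilTransport.castVec`, `S₀A_map`, `Lc_map`) is the sequel (not here).
Provenance: seat b2b-balaban-gan24-formalise-leaf-02 gen 45 (prover-…-leaf-02-g45-0), 2026-08-21; over the files named above BY NAME.
-/

namespace Summit.QuantumFields.BalabanUV.Beta.GAN24.WilsonStencilGaugeLeg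

open Finset
open scoped BigOperators Matrix
open Literature.MathematicalPhysics.QuantumFieldTheory.Balaban1983to89.Beta.SpinTable (br)
open Literature.MathematicalPhysics.QuantumFieldTheory.Balaban1983to89.Beta.PlaquetteVertex
open Literature.MathematicalPhysics.QuantumFieldTheory.Balaban1983to89.Beta.PlaquetteStencil (wilsonVertex₁
  actionJet21_eq_wilsonVertex₁)
open Literature.MathematicalPhysics.QuantumFieldTheory.Balaban1983to89.Beta.WilsonVertexKron (wilsonStencil₀
  wilsonVertex₁_apply_eq_mul)
open Summit.QuantumFields.BalabanUV.Beta.WilsonReflectionFrame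
open Summit.QuantumFields.BalabanUV.Beta.WilsonStencilReflection (tH YH τH τH_comm adM_witnessH)
open Summit.QuantumFields.BalabanUV.Beta.WilsonJetDivergence (grad grad_apply)
open Summit.QuantumFields.BalabanUV.Beta.WilsonStencilDivergence (curlCurl curlCurl_eq_two_mul_Lc lcurl₀_smul single_eq_bondLetter
  lcurl_comm_letter)
open Summit.QuantumFields.BalabanUV.Beta.GAN24.WilsonJetGaugeLeg (tipAdj midBr jet21_polar_grad)

/-! ## §0 The objects -/

section Defs

/-- [our object] **THE (DOUBLED) BOND-MIDPOINT WEIGHTING OF COORDINATES**: `(bondMul e ℓ v)(x,(a,k)) := (ℓ x + ℓ(x + e_k)) · v(x,(a,k))`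
(twice the weighting by the midpoint average of `ℓ` over the bond `(x,k)`).  A definition asserting nothing. -/
def bondMul {Λ : Type*} [AddCommGroup Λ] {C : Type*} {D : Type*} (e : D → Λ) (ell : Λ → ℝ) (v : Λ × (C × D) → ℝ) :
    Λ × (C × D) → ℝ :=
  fun P => (ell P.1 + ell (P.1 + e P.2.2)) * v P

/-- [folklore] entries of `bondMul`. -/
@[simp] theorem bondMul_apply {Λ : Type*} [AddCommGroup Λ] {C : Type*} {D : Type*} (e : D → Λ) (ell : Λ → ℝ)
    (v : Λ × (C × D) → ℝ) (P : Λ × (C × D)) : bondMul e ell v P = (ell P.1 + ell (P.1 + e P.2.2)) * v P := rfl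

end Defs

/-! ## §1 Coordinates -/

section Coordinates

variable {𝔸 : Type*} [NormedRing 𝔸] [NormedAlgebra ℝ 𝔸]
variable {Λ : Type*} [Fintype Λ] [DecidableEq Λ] [AddCommGroup Λ] {C : Type*} [Fintype C] [DecidableEq C]
  {D : Type*} [Fintype D] [DecidableEq D] {e : D → Λ}

omit [Fintype Λ] [DecidableEq Λ] [Fintype D] [DecidableEq D] in
/-- [folklore] **A COLOUR-SUPPORTED GRADIENT VECTOR IS A PURE-GAUGE FLUCTUATION**: the coordinate field of `cvec c (dℓ)` is
`grad e (ℓ • t_c)`. -/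
theorem field_cvec_grad (t : C → 𝔸) (c : C) (ell : Λ → ℝ) :
    field t (cvec c (fun p : Λ × D => ell (p.1 + e p.2) - ell p.1)) = grad e (fun x => ell x • t c) := by
  funext x k
  simp only [field, cvec, grad_apply, ite_smul, zero_smul, Finset.sum_ite_eq', Finset.mem_univ, if_true, sub_smul]

omit [Fintype Λ] [DecidableEq Λ] [AddCommGroup Λ] [DecidableEq C] [Fintype D] [DecidableEq D] in
/-- [folklore] the coordinate field is additive in the coordinates. -/
theorem field_add (t : C → 𝔸) (v w : Λ × (C × D) → ℝ) : field t (v + w) = field t v + field t w := by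
  funext x k
  simp only [field, Pi.add_apply, add_smul, Finset.sum_add_distrib]

omit [Fintype Λ] [DecidableEq Λ] [DecidableEq C] [Fintype D] [DecidableEq D] in
/-- [folklore] the coordinate field of the bond-weighted coordinates is the bond-weighted coordinate field. -/
theorem field_bondMul (t : C → 𝔸) (ell : Λ → ℝ) (v : Λ × (C × D) → ℝ) (x : Λ) (k : D) :
    field t (bondMul e ell v) x k = (ell x + ell (x + e k)) • field t v x k := by
  simp only [field, bondMul_apply, Finset.smul_sum, smul_smul]

omit [Fintype Λ] [DecidableEq Λ] [DecidableEq C] [Fintype D] [DecidableEq D] in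
/-- [folklore] **THE DOUBLED MIDPOINT CONJUGATION BY `ℓ • t_c` OF THE COORDINATE FIELD** is the commutator of `t_c` with the bond-weighted
coordinate field. -/
theorem midBr_smul_field (t : C → 𝔸) (ell : Λ → ℝ) (c : C) (v : Λ × (C × D) → ℝ) (x : Λ) (k : D) :
    midBr e (fun x => ell x • t c) (field t v) x k = t c * field t (bondMul e ell v) x k - field t (bondMul e ell v) x k * t c := by
  rw [WilsonJetGaugeLeg.midBr_apply, br, field_bondMul, ← add_smul, smul_mul_assoc, mul_smul_comm, mul_smul_comm, smul_mul_assoc]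

omit [Fintype Λ] [Fintype D] [NormedAlgebra ℝ 𝔸] [Fintype C] [DecidableEq C] in
/-- [folklore] **THE TIP CONJUGATION OF A ONE-BOND BACKGROUND** is a one-bond background: `tipAdj e λ (bondLetter z γ Y) =
bondLetter z γ [λ(z + e_γ), Y]`. -/
theorem tipAdj_bondLetter (lam : Λ → 𝔸) (z : Λ) (γ : D) (Y : 𝔸) :
    tipAdj e lam (bondLetter z γ Y) = bondLetter z γ (br (lam (z + e γ)) Y) := by
  funext x k
  simp only [WilsonJetGaugeLeg.tipAdj_apply, bondLetter, br]
  split_ifs with h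
  · rw [h.1, h.2]
  · rw [mul_zero, zero_mul, sub_self]

omit [Fintype Λ] [AddCommGroup Λ] [Fintype D] [Fintype C] [DecidableEq C] in
/-- [folklore] a one-bond background with letter `Y` is the scalar indicator bond field times `Y`. -/
theorem bondLetter_eq_smul (z : Λ) (γ : D) (Y : 𝔸) (x : Λ) (k : D) :
    bondLetter z γ Y x k = bondLetter z γ (1 : ℝ) x k • Y := by
  simp only [bondLetter]
  split_ifs <;> simp

omit [Fintype Λ] [Fintype D] [Fintype C] [DecidableEq C] in
/-- [folklore] the curl of a one-bond background is the curl of the indicator times the letter. -/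
theorem lcurl_bondLetter_smul (z : Λ) (γ : D) (Y : 𝔸) (x : Λ) (μ ν : D) :
    lcurl e (bondLetter z γ Y) x μ ν = lcurl e (bondLetter z γ (1 : ℝ)) x μ ν • Y := by
  simp only [lcurl, bondLetter_eq_smul (𝔸 := 𝔸) z γ Y, sub_smul]

omit [DecidableEq Λ] [Fintype Λ] [Fintype D] [DecidableEq D] [DecidableEq C] in
/-- [folklore] the trace of (scalar • letter) against the commutator of `t_c` with a coordinate combination:
`τ((φ•Y)·(t_c F − F t_c)) = φ · Σ_b (adM Y)_{cb} f_b`. -/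
theorem trace_smul_letter_comm_sum (τ : 𝔸 →ₗ[ℝ] ℝ) (t : C → 𝔸) (Y : 𝔸) (c : C) (φ : ℝ) (f : C → ℝ) :
    τ ((φ • Y) * (t c * (∑ b, f b • t b) - (∑ b, f b • t b) * t c)) = φ * ∑ b, adM τ t Y c b * f b := by
  rw [smul_mul_assoc, map_smul, smul_eq_mul]
  congr 1
  rw [show t c * (∑ b, f b • t b) - (∑ b, f b • t b) * t c = br (t c) (∑ b, f b • t b) from rfl]
  have h : br (t c) (∑ b, f b • t b) = ∑ b, f b • br (t c) (t b) := by
    simp only [br, Finset.mul_sum, Finset.sum_mul, mul_smul_comm, smul_mul_assoc, ← Finset.sum_sub_distrib, ← smul_sub]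
  rw [h, Finset.mul_sum, map_sum]
  refine Finset.sum_congr rfl fun b _ => ?_
  rw [mul_smul_comm, map_smul, smul_eq_mul, adM_apply, mul_comm]

omit [DecidableEq Λ] [Fintype Λ] [Fintype D] [DecidableEq D] [DecidableEq C] in
/-- [folklore] the trace of a coordinate combination against (scalar • [t_c, Y]): `τ((Σ_a g_a t_a)·(φ•[t_c, Y])) = −φ · Σ_a (adM Y)_{ca} g_a`
(tracial `τ`). -/
theorem trace_sum_mul_smul_br (τ : 𝔸 →ₗ[ℝ] ℝ) (hτ : ∀ a b : 𝔸, τ (a * b) = τ (b * a)) (t : C → 𝔸) (Y : 𝔸) (c : C) (φ : ℝ)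
    (g : C → ℝ) :
    τ ((∑ a, g a • t a) * (φ • br (t c) Y)) = -(φ * ∑ a, adM τ t Y c a * g a) := by
  rw [mul_smul_comm, map_smul, smul_eq_mul, Finset.sum_mul, map_sum, Finset.mul_sum, Finset.mul_sum, ← Finset.sum_neg_distrib]
  refine Finset.sum_congr rfl fun a _ => ?_
  rw [smul_mul_assoc, map_smul, smul_eq_mul, adM_apply]
  have e1 : τ (t a * (t c * Y)) = τ (Y * (t a * t c)) := by rw [← mul_assoc, hτ (t a * t c) Y]
  have e2 : τ (t a * (Y * t c)) = τ (Y * (t c * t a)) := by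
    rw [← mul_assoc, hτ (t a * Y) (t c), ← mul_assoc, hτ (t c * t a) Y]
  have h : τ (t a * br (t c) Y) = -τ (Y * br (t c) (t a)) := by
    simp only [br, mul_sub, map_sub, e1, e2]
    ring
  rw [h]
  ring


/-! ### the two sides of `jet21_polar_grad` in coordinates -/


omit [DecidableEq C] in
/-- [folklore] **THE MIDPOINT TERM IN COORDINATES**: for `W = field t v`, `λ = ℓ • t_c`, `B = bondLetter z γ Y`,
`Σ_x Σ_μν ½•τ(lcurl B · lcurl (midBr λ W)) = ½ · Σ_x Σ_μν lcurl δ_{(z,γ)} · Σ_b (adM Y)_{cb} · lcurl (coords (bondMul ℓ v))_b`. -/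
theorem rhs_mid_coords (τ : 𝔸 →ₗ[ℝ] ℝ) (t : C → 𝔸) (ell : Λ → ℝ) (c : C) (Y : 𝔸) (z : Λ) (γ : D) (v : Λ × (C × D) → ℝ) :
    (∑ x, ∑ μ, ∑ ν, (2 : ℝ)⁻¹ • τ (lcurl e (bondLetter z γ Y) x μ ν *
        lcurl e (midBr e (fun x => ell x • t c) (field t v)) x μ ν)) =
      (2 : ℝ)⁻¹ * ∑ x, ∑ μ, ∑ ν, lcurl e (bondLetter z γ (1 : ℝ)) x μ ν *
        ∑ b, adM τ t Y c b * lcurl e (coords (bondMul e ell v)) x μ ν b := by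
  have hmid : midBr e (fun x => ell x • t c) (field t v) =
      fun x k => t c * field t (bondMul e ell v) x k - field t (bondMul e ell v) x k * t c := by
    funext x k; exact midBr_smul_field t ell c v x k
  rw [hmid, Finset.mul_sum]
  refine Finset.sum_congr rfl fun x _ => ?_
  rw [Finset.mul_sum]
  refine Finset.sum_congr rfl fun μ _ => ?_
  rw [Finset.mul_sum]
  refine Finset.sum_congr rfl fun ν _ => ?_
  rw [lcurl_comm_letter, lcurl_bondLetter_smul, lcurl_field, trace_smul_letter_comm_sum, smul_eq_mul]

omit [DecidableEq C] in
/-- [folklore] **THE TIP TERM IN COORDINATES**: for `W = field t v`, `λ = ℓ • t_c`, `B = bondLetter z γ Y`,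
`Σ_x Σ_μν τ(lcurl W · lcurl (tipAdj λ B)) = −ℓ(z + e_γ) · Σ_x Σ_μν lcurl δ_{(z,γ)} · Σ_a (adM Y)_{ca} · lcurl (coords v)_a`. -/
theorem rhs_tip_coords (τ : 𝔸 →ₗ[ℝ] ℝ) (hτ : ∀ a b : 𝔸, τ (a * b) = τ (b * a)) (t : C → 𝔸) (ell : Λ → ℝ) (c : C) (Y : 𝔸)
    (z : Λ) (γ : D) (v : Λ × (C × D) → ℝ) :
    (∑ x, ∑ μ, ∑ ν, τ (lcurl e (field t v) x μ ν * lcurl e (tipAdj e (fun x => ell x • t c) (bondLetter z γ Y)) x μ ν)) =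
      -(ell (z + e γ) * ∑ x, ∑ μ, ∑ ν, lcurl e (bondLetter z γ (1 : ℝ)) x μ ν *
        ∑ a, adM τ t Y c a * lcurl e (coords v) x μ ν a) := by
  have htip : tipAdj e (fun x => ell x • t c) (bondLetter z γ Y) = bondLetter z γ (ell (z + e γ) • br (t c) Y) := by
    rw [tipAdj_bondLetter]
    simp only [br, smul_mul_assoc, mul_smul_comm, smul_sub]
  rw [htip, Finset.mul_sum, ← Finset.sum_neg_distrib]
  refine Finset.sum_congr rfl fun x _ => ?_
  rw [Finset.mul_sum, ← Finset.sum_neg_distrib]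
  refine Finset.sum_congr rfl fun μ _ => ?_
  rw [Finset.mul_sum, ← Finset.sum_neg_distrib]
  refine Finset.sum_congr rfl fun ν _ => ?_
  rw [lcurl_bondLetter_smul, lcurl_field, smul_smul, trace_sum_mul_smul_br τ hτ]
  ring

omit [DecidableEq C] in
/-- [folklore] **THE LEFT SIDE IN COORDINATES**: at the one-bond background `B = bondLetter z γ Y` the summed `(2,1)`-jet of the
coordinate field is minus the quadratic form of an3's first-order vertex: `jet21 ℝ τ e (field t v) B = −v ⬝ᵥ W(z, γ, adM Y) v`
(`PlaquetteStencil.actionJet21_eq_wilsonVertex₁`). -/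
theorem jet21_field_bondLetter (τ : 𝔸 →ₗ[ℝ] ℝ) (hτ : ∀ a b : 𝔸, τ (a * b) = τ (b * a)) (t : C → 𝔸) (z : Λ) (γ : D) (Y : 𝔸)
    (v : Λ × (C × D) → ℝ) :
    jet21 ℝ τ e (field t v) (bondLetter z γ Y) = -(v ⬝ᵥ (wilsonVertex₁ e z γ (adM τ t Y) *ᵥ v)) := by
  have h := actionJet21_eq_wilsonVertex₁ τ hτ t e v z γ Y
  linarith

/-- [folklore] **THE BILINEAR-FORM GAUGE-LEG LAW.**  For every finite lattice, frame, normed algebra, tracial `τ`, letter family `t`,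
colour `c`, background bond `(z, γ)` with letter `Y`, scalar site profile `ℓ` and every fluctuation `v` in coordinates, with
`v′ := cvec c (dℓ)` (the pure gauge `grad (ℓ • t_c)` in coordinates) and `W := wilsonVertex₁ e z γ (adM τ t Y)`:
`v ⬝ᵥ W v′ + v′ ⬝ᵥ W v = −½·Σ_x Σ_μν lcurl δ_{(z,γ)} · Σ_b (adM Y)_{cb} lcurl (coords (bondMul ℓ v))_b
                        + ℓ(z + e_γ) · Σ_x Σ_μν lcurl δ_{(z,γ)} · Σ_a (adM Y)_{ca} lcurl (coords v)_a`
— `jet21_polar_grad` read in coordinates on both sides. -/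
theorem bilinear_gauge_law (τ : 𝔸 →ₗ[ℝ] ℝ) (hτ : ∀ a b : 𝔸, τ (a * b) = τ (b * a)) (t : C → 𝔸) (ell : Λ → ℝ) (c : C) (Y : 𝔸)
    (z : Λ) (γ : D) (v : Λ × (C × D) → ℝ) :
    v ⬝ᵥ (wilsonVertex₁ e z γ (adM τ t Y) *ᵥ cvec c (fun p : Λ × D => ell (p.1 + e p.2) - ell p.1))
      + cvec c (fun p : Λ × D => ell (p.1 + e p.2) - ell p.1) ⬝ᵥ (wilsonVertex₁ e z γ (adM τ t Y) *ᵥ v) =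
      -((2 : ℝ)⁻¹ * ∑ x, ∑ μ, ∑ ν, lcurl e (bondLetter z γ (1 : ℝ)) x μ ν *
          ∑ b, adM τ t Y c b * lcurl e (coords (bondMul e ell v)) x μ ν b)
        + ell (z + e γ) * ∑ x, ∑ μ, ∑ ν, lcurl e (bondLetter z γ (1 : ℝ)) x μ ν *
          ∑ a, adM τ t Y c a * lcurl e (coords v) x μ ν a := by
  set v' : Λ × (C × D) → ℝ := cvec c (fun p : Λ × D => ell (p.1 + e p.2) - ell p.1) with hv'
  set W := wilsonVertex₁ e z γ (adM τ t Y) with hW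
  have hj := jet21_polar_grad ℝ τ hτ e (field t v) (bondLetter z γ Y) (fun x => ell x • t c)
  have hg : grad e (fun x => ell x • t c) = field t v' := (field_cvec_grad t c ell).symm
  rw [hg, ← field_add, jet21_field_bondLetter τ hτ, jet21_field_bondLetter τ hτ, jet21_field_bondLetter τ hτ] at hj
  simp only [Finset.sum_add_distrib] at hj
  rw [rhs_mid_coords τ, rhs_tip_coords τ hτ] at hj
  have hq : (v + v') ⬝ᵥ (W *ᵥ (v + v')) = v ⬝ᵥ (W *ᵥ v) + v ⬝ᵥ (W *ᵥ v') + (v' ⬝ᵥ (W *ᵥ v) + v' ⬝ᵥ (W *ᵥ v')) := by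
    rw [Matrix.mulVec_add, dotProduct_add, add_dotProduct, add_dotProduct]
    ring
  rw [← hW] at hj
  rw [hq] at hj
  linarith


/-! ### the test vector -/

omit [Fintype Λ] [DecidableEq Λ] [Fintype C] [Fintype D] [DecidableEq D] [NormedRing 𝔸] [NormedAlgebra ℝ 𝔸] in
/-- [folklore] bond-weighting a colour-supported vector weights its colourless profile. -/
theorem bondMul_cvec (ell : Λ → ℝ) (b : C) (ψ : Λ × D → ℝ) :
    bondMul e ell (cvec b ψ) = cvec b (fun p => (ell p.1 + ell (p.1 + e p.2)) * ψ p) := by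
  funext P; simp only [bondMul_apply, cvec]; split_ifs <;> simp

omit [Fintype Λ] [Fintype C] [DecidableEq C] [Fintype D] [NormedRing 𝔸] [NormedAlgebra ℝ 𝔸] in
/-- [folklore] bond-weighting a delta profile scales it by the (doubled) midpoint weight of its bond. -/
theorem bondMul₀_single (ell : Λ → ℝ) (q : Λ × D) :
    (fun p : Λ × D => (ell p.1 + ell (p.1 + e p.2)) * (Pi.single q (1 : ℝ) : Λ × D → ℝ) p) =
      (ell q.1 + ell (q.1 + e q.2)) • (Pi.single q (1 : ℝ) : Λ × D → ℝ) := by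
  funext p
  simp only [Pi.smul_apply, smul_eq_mul, Pi.single_apply]
  split_ifs with h
  · rw [h]
  · rw [mul_zero, mul_zero]

/-- [folklore] **THE ENTRYWISE GAUGE-LEG LAW WITH COLOUR.**  At the test vector `v = cvec b δ_q` the bilinear-form law reads
`(adM Y)_{cb} · 2 · Σ_p (ℓ(p.1 + e_{p.2}) − ℓ p.1) · S₀A(z, γ; p, q) = (adM Y)_{cb} · (ℓ(z + e_γ) − ½(ℓ q.1 + ℓ(q.1 + e_{q.2}))) · curlCurl e (z,γ) q`
(`cvec_wilsonVertex₁_cvec`, `adM_antisymm`; the antisymmetrised stencil `S₀A` appears because the two cross terms carry `(adM Y)_{bc} = −(adM Y)_{cb}`). -/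
theorem entry_gauge_law_colour (τ : 𝔸 →ₗ[ℝ] ℝ) (hτ : ∀ a b : 𝔸, τ (a * b) = τ (b * a)) (t : C → 𝔸) (ell : Λ → ℝ) (c b : C)
    (Y : 𝔸) (z : Λ) (γ : D) (q : Λ × D) :
    adM τ t Y c b * (2 * ∑ p, (ell (p.1 + e p.2) - ell p.1) * S₀A e z γ p q) =
      adM τ t Y c b * ((ell (z + e γ) - (ell q.1 + ell (q.1 + e q.2)) / 2) * curlCurl e (z, γ) q) := by
  have h := bilinear_gauge_law (e := e) τ hτ t ell c Y z γ (cvec b (Pi.single q 1))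
  have hbc : adM τ t Y b c = -adM τ t Y c b := adM_antisymm τ t Y c b
  rw [cvec_wilsonVertex₁_cvec, cvec_wilsonVertex₁_cvec, hbc] at h
  -- the two pairings on the left
  have h1 : (Pi.single q (1 : ℝ) : Λ × D → ℝ) ⬝ᵥ (wilsonStencil₀ e z γ *ᵥ fun p => ell (p.1 + e p.2) - ell p.1) =
      ∑ p, wilsonStencil₀ e z γ q p * (ell (p.1 + e p.2) - ell p.1) := by
    rw [single_one_dotProduct, Matrix.mulVec, dotProduct]
  have h2 : (fun p : Λ × D => ell (p.1 + e p.2) - ell p.1) ⬝ᵥ (wilsonStencil₀ e z γ *ᵥ (Pi.single q (1 : ℝ))) =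
      ∑ p, (ell (p.1 + e p.2) - ell p.1) * wilsonStencil₀ e z γ p q := by
    rw [Matrix.mulVec_single_one, dotProduct]
    rfl
  -- the two sums on the right
  have hR1 : ∀ (x : Λ) (μ ν : D), (∑ b', adM τ t Y c b' * lcurl e (coords (bondMul e ell (cvec b (Pi.single q 1)))) x μ ν b') =
      adM τ t Y c b * ((ell q.1 + ell (q.1 + e q.2)) *
        lcurl e (fun y κ => (Pi.single q (1 : ℝ) : Λ × D → ℝ) (y, κ)) x μ ν) := by
    intro x μ ν
    simp only [bondMul_cvec, bondMul₀_single, lcurl_coords_cvec, lcurl₀_smul, mul_ite, mul_zero, Finset.sum_ite_eq',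
      Finset.mem_univ, if_true]
  have hR2 : ∀ (x : Λ) (μ ν : D), (∑ a, adM τ t Y c a * lcurl e (coords (cvec b (Pi.single q 1))) x μ ν a) =
      adM τ t Y c b * lcurl e (fun y κ => (Pi.single q (1 : ℝ) : Λ × D → ℝ) (y, κ)) x μ ν := by
    intro x μ ν
    simp only [lcurl_coords_cvec, mul_ite, mul_zero, Finset.sum_ite_eq', Finset.mem_univ, if_true]
  rw [h1, h2] at h
  simp only [hR1, hR2] at h
  -- normal forms
  set CC := ∑ x, ∑ μ, ∑ ν, lcurl e (bondLetter z γ (1 : ℝ)) x μ ν *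
    lcurl e (fun y κ => (Pi.single q (1 : ℝ) : Λ × D → ℝ) (y, κ)) x μ ν with hCC
  have e3 : (∑ x, ∑ μ, ∑ ν, lcurl e (bondLetter z γ (1 : ℝ)) x μ ν * (adM τ t Y c b * ((ell q.1 + ell (q.1 + e q.2)) *
      lcurl e (fun y κ => (Pi.single q (1 : ℝ) : Λ × D → ℝ) (y, κ)) x μ ν))) = adM τ t Y c b * (ell q.1 + ell (q.1 + e q.2)) * CC := by
    rw [hCC, Finset.mul_sum]
    refine Finset.sum_congr rfl fun x _ => ?_
    rw [Finset.mul_sum]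
    refine Finset.sum_congr rfl fun μ _ => ?_
    rw [Finset.mul_sum]
    refine Finset.sum_congr rfl fun ν _ => ?_
    ring
  have e4 : (∑ x, ∑ μ, ∑ ν, lcurl e (bondLetter z γ (1 : ℝ)) x μ ν * (adM τ t Y c b *
      lcurl e (fun y κ => (Pi.single q (1 : ℝ) : Λ × D → ℝ) (y, κ)) x μ ν)) = adM τ t Y c b * CC := by
    rw [hCC, Finset.mul_sum]
    refine Finset.sum_congr rfl fun x _ => ?_
    rw [Finset.mul_sum]
    refine Finset.sum_congr rfl fun μ _ => ?_
    rw [Finset.mul_sum]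
    refine Finset.sum_congr rfl fun ν _ => ?_
    ring
  rw [e3, e4] at h
  have hS : (2 * ∑ p, (ell (p.1 + e p.2) - ell p.1) * S₀A e z γ p q) =
      (∑ p, (ell (p.1 + e p.2) - ell p.1) * wilsonStencil₀ e z γ p q) -
        ∑ p, wilsonStencil₀ e z γ q p * (ell (p.1 + e p.2) - ell p.1) := by
    unfold S₀A
    rw [Finset.mul_sum, ← Finset.sum_sub_distrib]
    refine Finset.sum_congr rfl fun p _ => ?_
    ring
  have hC : curlCurl e (z, γ) q = CC := by
    rw [hCC, curlCurl, single_eq_bondLetter (z, γ)]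
  rw [hS, hC]
  linear_combination h

end Coordinates

/-! ### the colourless law -/

section Colourless

/-- [folklore] **THE GAUGE-LEG (TABLE-LEG WARD) LAW OF THE ANTISYMMETRISED WILSON STENCIL, smeared form (entrywise, colourless).**  On
every finite abelian lattice `Λ` with frame `e : D → Λ`, for every scalar site profile `ℓ`, every background bond `(z, γ)` and every bond
`q`:  `Σ_p (ℓ(p.1 + e_{p.2}) − ℓ p.1) · S₀A e z γ p q = (ℓ(z + e_γ) − ½(ℓ q.1 + ℓ(q.1 + e_{q.2}))) · Lc e q.2 q.1 (z, γ)` — the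
antisymmetrised colourless Wilson stencil contracted with the pure gauge `grad ℓ` on a TABLE leg is the curl–curl contact between the
background bond and the other table leg, weighted by the TIP value of `ℓ` on the background bond minus the MIDPOINT value of `ℓ` on the other
leg.  (Compare the INDEX-leg law `WilsonStencilDivergence.S₀A_grad`: SITE values `ℓ q.1 − ℓ p.1`.)  Proof: `entry_gauge_law_colour` at the
quaternion witness `WilsonStencilReflection.adM_witnessH` and `WilsonStencilDivergence.curlCurl_eq_two_mul_Lc`. -/
theorem S₀A_gaugeLeg {Λ : Type*} [Fintype Λ] [DecidableEq Λ] [AddCommGroup Λ] {D : Type*} [Fintype D] [DecidableEq D]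
    (e : D → Λ) (ell : Λ → ℝ) (z : Λ) (γ : D) (q : Λ × D) :
    (∑ p, (ell (p.1 + e p.2) - ell p.1) * S₀A e z γ p q) =
      (ell (z + e γ) - (ell q.1 + ell (q.1 + e q.2)) / 2) * Lc e q.2 q.1 (z, γ) := by
  have h := entry_gauge_law_colour (e := e) τH τH_comm tH ell 0 1 YH z γ q
  rw [adM_witnessH, one_mul, one_mul, curlCurl_eq_two_mul_Lc] at h
  linear_combination (1 / 2 : ℝ) * h

/-- [folklore] **THE GAUGE-LEG LAW AT ONE SITE (entrywise, colourless).**  For every site `u`, background bond `(z, γ)` and bond `q`: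
`Σ_κ (S₀A e z γ (u − e_κ, κ) q − S₀A e z γ (u, κ) q) = ([z + e_γ = u] − ½([q.1 = u] + [q.1 + e_{q.2} = u])) · Lc e q.2 q.1 (z, γ)` —
the response of the antisymmetric Wilson stencil to the pure-gauge FLUCTUATION `grad δ_u` on a table leg. -/
theorem S₀A_gaugeLeg_div {Λ : Type*} [Fintype Λ] [DecidableEq Λ] [AddCommGroup Λ] {D : Type*} [Fintype D] [DecidableEq D]
    (e : D → Λ) (u : Λ) (z : Λ) (γ : D) (q : Λ × D) :
    (∑ κ, (S₀A e z γ (u - e κ, κ) q - S₀A e z γ (u, κ) q)) =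
      ((if z + e γ = u then 1 else 0) - ((if q.1 = u then 1 else 0) + (if q.1 + e q.2 = u then 1 else 0)) / 2) *
        Lc e q.2 q.1 (z, γ) := by
  have h := S₀A_gaugeLeg e (fun x => if x = u then (1 : ℝ) else 0) z γ q
  rw [← h, Fintype.sum_prod_type, Finset.sum_comm]
  refine Finset.sum_congr rfl fun κ _ => ?_
  have hsplit : ∀ x : Λ, ((if x + e κ = u then (1 : ℝ) else 0) - if x = u then 1 else 0) * S₀A e z γ (x, κ) q =
      (if x = u - e κ then S₀A e z γ (x, κ) q else 0) - (if x = u then S₀A e z γ (x, κ) q else 0) := by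
    intro x
    simp only [← eq_sub_iff_add_eq]
    split_ifs <;> ring
  simp only [hsplit, Finset.sum_sub_distrib, Finset.sum_ite_eq', Finset.mem_univ, if_true]

end Colourless

end Summit.QuantumFields.BalabanUV.Beta.GAN24.WilsonStencilGaugeLeg
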